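import Summits.Ventures.PercRepro.S1FiveCircuitX
import Summits.Ventures.PercRepro.S1FourCircuitW2

/-!
# PercRepro — LEMMA X⁺, part 1: the charge of a `4`-set (p2, gen 18)

LEMMA X (`S1FiveCircuitX`) charges every `4`-subset `Q` of `E` with at most `6` five-circuits: the fifth point lies
in `cl Q ∖ Q`, which has `≤ 6` points by (C3). The EXCLUDED points of `Q` — the points `e ∉ Q` lying on a triangle whose
other two points are in `Q` — lie in `cl Q ∖ Q` too and are the fifth point of no five-circuit through `Q` (the triangle
would sit inside the circuit); a DEPENDENT `4`-set (rank `≤ 3`) has `cl Q` a plane with `≤ 6` points by (C2), so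
`#(cl Q ∖ Q) ≤ 2`. Hence the charge `#fifth(Q) + #excl(Q) + 4·[Q dependent] ≤ 6`. Parts 2 and 3 (`S1FiveCircuitX2B`,
`S1FiveCircuitX2C`) count the excluded points and the dependent `4`-sets and assemble LEMMA X⁺.

* `excl M Q`, `fifth M Q` — the excluded points and the five-circuits of a `4`-set, as finsets;
* `sum_card_fifth` — `Σ_Q #fifth(Q) = 5·s₅`;
* `card_fifth_add_card_excl_le` — the charge of a `4`-set: `#fifth + #excl + 4·[Q dependent] ≤ 6`;
* `card_filter_triangles_through_subset_le_two` — at most two triangles through `e` with their other points in a `4`-set.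
Axioms: standard.
-/

open scoped Matroid

namespace PercRepro

namespace S1

open Set

variable {α : Type}

open Classical in
/-- `excl M Q`: the points of `E` outside `Q` lying on a triangle whose other two points are in `Q`. -/
noncomputable def excl (M : Matroid α) [M.Finite] (Q : Finset α) : Finset α :=
  M.ground_finite.toFinset.filter
    (fun e => e ∉ Q ∧ ∃ T ∈ ThmN.triangles M, e ∈ T ∧ T \ {e} ⊆ ((Q : Finset α) : Set α))

open Classical in
/-- `fifth M Q`: the five-circuits containing the `4`-set `Q`. -/
noncomputable def fifth (M : Matroid α) [M.Finite] (Q : Finset α) : Finset (Set α) :=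
  (finite_fiveCircuits M).toFinset.filter (fun C => ((Q : Finset α) : Set α) ⊆ C)

/-- Membership in `excl`. -/
theorem mem_excl (M : Matroid α) [M.Finite] {Q : Finset α} {e : α} :
    e ∈ excl M Q ↔ e ∈ M.E ∧ e ∉ Q ∧ ∃ T ∈ ThmN.triangles M, e ∈ T ∧ T \ {e} ⊆ ((Q : Finset α) : Set α) := by
  simp only [excl, Finset.mem_filter, Set.Finite.mem_toFinset]

/-- Membership in `fifth`. -/
theorem mem_fifth (M : Matroid α) [M.Finite] {Q : Finset α} {C : Set α} :
    C ∈ fifth M Q ↔ (M.IsCircuit C ∧ C.ncard = 5) ∧ ((Q : Finset α) : Set α) ⊆ C := by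
  simp only [fifth, Finset.mem_filter, Set.Finite.mem_toFinset]
  rfl

open Classical in
/-- **`Σ_Q #fifth(Q) = 5·s₅`** over the `4`-subsets `Q` of `E`: every five-circuit has `5` four-subsets. -/
theorem sum_card_fifth (M : Matroid α) [M.Finite] :
    ∑ Q ∈ M.ground_finite.toFinset.powersetCard 4, (fifth M Q).card =
      5 * (finite_fiveCircuits M).toFinset.card := by
  classical
  have h54 : Nat.choose 5 4 = 5 := by decide
  calc ∑ Q ∈ M.ground_finite.toFinset.powersetCard 4, (fifth M Q).card
      = ∑ Q ∈ M.ground_finite.toFinset.powersetCard 4, ∑ C ∈ (finite_fiveCircuits M).toFinset,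
          (if ((Q : Finset α) : Set α) ⊆ C then 1 else 0) := by
        apply Finset.sum_congr rfl
        intro Q _
        rw [fifth, Finset.card_filter]
    _ = ∑ C ∈ (finite_fiveCircuits M).toFinset, ∑ Q ∈ M.ground_finite.toFinset.powersetCard 4,
          (if ((Q : Finset α) : Set α) ⊆ C then 1 else 0) := Finset.sum_comm
    _ = ∑ _C ∈ (finite_fiveCircuits M).toFinset, 5 := by
        apply Finset.sum_congr rfl
        intro C hC
        rw [Set.Finite.mem_toFinset] at hC
        have hCE : C ⊆ M.E := hC.1.subset_ground
        have hCfin : C.Finite := M.ground_finite.subset hCE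
        rw [Finset.sum_boole, Nat.cast_id]
        have hfilter : (M.ground_finite.toFinset.powersetCard 4).filter (fun Q => ((Q : Finset α) : Set α) ⊆ C) =
            hCfin.toFinset.powersetCard 4 := by
          ext Q
          simp only [Finset.mem_filter, Finset.mem_powersetCard, Set.Finite.subset_toFinset]
          constructor
          · rintro ⟨⟨-, h4⟩, hQC⟩
            exact ⟨hQC, h4⟩
          · rintro ⟨hQC, h4⟩
            exact ⟨⟨hQC.trans hCE, h4⟩, hQC⟩
        rw [hfilter, Finset.card_powersetCard, ← Set.ncard_eq_toFinset_card C hCfin, hC.2, h54]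
    _ = 5 * (finite_fiveCircuits M).toFinset.card := by rw [Finset.sum_const, smul_eq_mul, mul_comm]

open Classical in
/-- **The charge of a `4`-set**: `#fifth(Q) + #excl(Q) + 4·[Q dependent] ≤ 6` (under (C2), (C3)). The fifth
points and the excluded points are disjoint subsets of `cl Q ∖ Q`, which has `≤ 6` points — `≤ 2` when `Q` is
dependent (`cl Q` is then a plane). -/
theorem card_fifth_add_card_excl_le (M : Matroid α) [M.Finite]
    (hC2 : ∀ P ⊆ M.E, M.eRk P ≤ 3 → P.ncard ≤ 6) (hC3 : ∀ X ⊆ M.E, M.eRk X ≤ 4 → X.ncard ≤ 10)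
    {Q : Finset α} (hQ : Q ∈ M.ground_finite.toFinset.powersetCard 4) :
    (fifth M Q).card + (excl M Q).card + 4 * (if M.Indep ((Q : Finset α) : Set α) then 0 else 1) ≤ 6 := by
  classical
  rw [Finset.mem_powersetCard] at hQ
  obtain ⟨hQE, hQ4⟩ := hQ
  have hQE' : ((Q : Finset α) : Set α) ⊆ M.E := Set.Finite.subset_toFinset.1 hQE
  have hQfin : ((Q : Finset α) : Set α).Finite := Q.finite_toSet
  have hQn : ((Q : Finset α) : Set α).ncard = 4 := by rw [Set.ncard_coe_finset, hQ4]
  have hclE : M.closure ((Q : Finset α) : Set α) ⊆ M.E := M.closure_subset_ground _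
  have hclfin : (M.closure ((Q : Finset α) : Set α)).Finite := M.ground_finite.subset hclE
  have hXcl : ((Q : Finset α) : Set α) ⊆ M.closure ((Q : Finset α) : Set α) := M.subset_closure _ hQE'
  have hDfin : (M.closure ((Q : Finset α) : Set α) \ ↑Q).Finite := hclfin.subset Set.sdiff_subset
  have hencard : ((Q : Finset α) : Set α).encard = 4 := by
    rw [← hQfin.cast_ncard_eq, hQn]
    rfl
  have hD6 : (M.closure ((Q : Finset α) : Set α) \ ↑Q).ncard ≤ 6 := by
    have hr : M.eRk (M.closure ((Q : Finset α) : Set α)) ≤ 4 := by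
      rw [M.eRk_closure_eq]
      exact (M.eRk_le_encard _).trans (le_of_eq hencard)
    have := hC3 _ hclE hr
    rw [Set.ncard_sdiff' hXcl hclfin, hQn]
    omega
  have hD2 : ¬ M.Indep ((Q : Finset α) : Set α) → (M.closure ((Q : Finset α) : Set α) \ ↑Q).ncard ≤ 2 := by
    intro hdep
    have hDep : M.Dep ((Q : Finset α) : Set α) := M.dep_iff.2 ⟨hdep, hQE'⟩
    have hlt := M.eRk_lt_encard_of_dep_of_finite hQfin hDep
    rw [hencard, show (4 : ℕ∞) = 3 + 1 by norm_num] at hlt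
    have hr : M.eRk (M.closure ((Q : Finset α) : Set α)) ≤ 3 := by
      rw [M.eRk_closure_eq]
      exact Order.le_of_lt_add_one hlt
    have := hC2 _ hclE hr
    rw [Set.ncard_sdiff' hXcl hclfin, hQn]
    omega
  -- `excl Q ⊆ cl Q ∖ Q`
  have hexclD : excl M Q ⊆ hDfin.toFinset := by
    intro e he
    rw [mem_excl] at he
    obtain ⟨_, heQ, T, hT, heT, hTQ⟩ := he
    rw [Set.Finite.mem_toFinset]
    refine ⟨?_, heQ⟩
    have h := hT.1.mem_closure_sdiff_singleton_of_mem heT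
    exact M.closure_subset_closure hTQ h
  -- `#fifth(Q) ≤ #(cl Q ∖ Q ∖ excl Q)`: the fifth point `f ↦ insert f Q` is a surjection
  have hfifth : (fifth M Q).card ≤ (hDfin.toFinset \ excl M Q).card := by
    refine Finset.card_le_card_of_surjOn (fun f => insert f ((Q : Finset α) : Set α)) ?_
    intro C hC
    rw [Finset.mem_coe, mem_fifth] at hC
    obtain ⟨⟨hCc, hC5⟩, hQC⟩ := hC
    have hCfin : C.Finite := M.ground_finite.subset hCc.subset_ground
    obtain ⟨f, hfC, hfQ⟩ : ∃ f, f ∈ C ∧ f ∉ ((Q : Finset α) : Set α) :=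
      Set.exists_mem_notMem_of_ncard_lt_ncard (by rw [hQn, hC5]; norm_num) hQfin
    have hCeq : insert f ((Q : Finset α) : Set α) = C := by
      refine Set.eq_of_subset_of_ncard_le (Set.insert_subset hfC hQC) ?_ hCfin
      rw [hC5, Set.ncard_insert_of_notMem hfQ hQfin, hQn]
    refine ⟨f, ?_, hCeq⟩
    rw [Finset.mem_coe, Finset.mem_sdiff, Set.Finite.mem_toFinset]
    refine ⟨⟨?_, hfQ⟩, ?_⟩
    · have h := hCc.mem_closure_sdiff_singleton_of_mem hfC
      refine M.closure_subset_closure ?_ h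
      intro z hz
      rw [← hCeq] at hz
      obtain ⟨hz1, hz2⟩ := hz
      rcases hz1 with rfl | hz1
      · exact (hz2 (Set.mem_singleton _)).elim
      · exact hz1
    · intro hf
      rw [mem_excl] at hf
      obtain ⟨-, -, T, hT, hfT, hTQ⟩ := hf
      have hTC : T ⊆ C := by
        intro z hz
        by_cases hzf : z = f
        · rw [hzf]; exact hfC
        · exact hQC (hTQ ⟨hz, hzf⟩)
      have hTC' : T ⊂ C := hTC.ssubset_of_ne (by
        intro h
        have h3 := hT.2
        rw [h, hC5] at h3
        omega)
      exact hT.1.dep.not_indep (hCc.ssubset_indep hTC')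
  have hsplit : (hDfin.toFinset \ excl M Q).card + (excl M Q).card = hDfin.toFinset.card :=
    Finset.card_sdiff_add_card_eq_card hexclD
  have hDcard : hDfin.toFinset.card = (M.closure ((Q : Finset α) : Set α) \ ↑Q).ncard :=
    (Set.ncard_eq_toFinset_card _ _).symm
  split_ifs with hind
  · omega
  · have := hD2 hind
    omega

open Classical in
/-- **At most two triangles through `e` with their other points in a `4`-set `Q`** (under (C1)): their other
points form pairwise disjoint pairs inside `Q`. -/
theorem card_filter_triangles_through_subset_le_two (M : Matroid α) [M.Finite]
    (hC1 : ∀ L ⊆ M.E, M.eRk L = 2 → L.ncard ≤ 3) {Q : Finset α} (hQ4 : Q.card = 4) (e : α) :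
    ((finite_triangles M).toFinset.filter (fun T => e ∈ T ∧ T \ {e} ⊆ ((Q : Finset α) : Set α))).card ≤ 2 := by
  classical
  by_contra hlt
  push Not at hlt
  obtain ⟨T₁, h₁, T₂, h₂, T₃, h₃, h12, h13, h23⟩ := Finset.two_lt_card.1 hlt
  rw [Finset.mem_filter, Set.Finite.mem_toFinset] at h₁ h₂ h₃
  have hQfin : ((Q : Finset α) : Set α).Finite := Q.finite_toSet
  have hQn : ((Q : Finset α) : Set α).ncard = 4 := by rw [Set.ncard_coe_finset, hQ4]
  -- each `Tᵢ ∖ {e}` has two points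
  have hcard : ∀ T, T ∈ ThmN.triangles M → e ∈ T → (T \ {e}).ncard = 2 := by
    intro T hT heT
    rw [Set.ncard_sdiff_singleton_of_mem heT, hT.2]
  -- pairwise disjoint, by (C1)
  have hdisj : ∀ T T', T ∈ ThmN.triangles M → T' ∈ ThmN.triangles M → e ∈ T → e ∈ T' → T ≠ T' →
      Disjoint (T \ {e}) (T' \ {e}) := by
    intro T T' hT hT' heT heT' hne
    have h := ThmN.inter_eq_singleton_of_mem_trianglesThrough M hC1 (x := e) ⟨hT.1, hT.2, heT⟩
      ⟨hT'.1, hT'.2, heT'⟩ hne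
    rw [Set.disjoint_left]
    intro z hz hz'
    have hmem : z ∈ T ∩ T' := ⟨hz.1, hz'.1⟩
    rw [h] at hmem
    exact hz.2 hmem
  have hfin : ∀ T, T ∈ ThmN.triangles M → (T \ {e}).Finite := fun T hT =>
    (M.ground_finite.subset hT.1.subset_ground).subset Set.sdiff_subset
  have hU : ((T₁ \ {e}) ∪ (T₂ \ {e}) ∪ (T₃ \ {e})).ncard = 6 := by
    rw [Set.ncard_union_eq (Set.disjoint_union_left.2 ⟨hdisj _ _ h₁.1 h₃.1 h₁.2.1 h₃.2.1 h13,
        hdisj _ _ h₂.1 h₃.1 h₂.2.1 h₃.2.1 h23⟩) ((hfin _ h₁.1).union (hfin _ h₂.1)) (hfin _ h₃.1),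
      Set.ncard_union_eq (hdisj _ _ h₁.1 h₂.1 h₁.2.1 h₂.2.1 h12) (hfin _ h₁.1) (hfin _ h₂.1),
      hcard _ h₁.1 h₁.2.1, hcard _ h₂.1 h₂.2.1, hcard _ h₃.1 h₃.2.1]
  have hsub : (T₁ \ {e}) ∪ (T₂ \ {e}) ∪ (T₃ \ {e}) ⊆ ((Q : Finset α) : Set α) :=
    Set.union_subset (Set.union_subset h₁.2.2 h₂.2.2) h₃.2.2
  have := Set.ncard_le_ncard hsub hQfin
  rw [hU, hQn] at this
  omega

end S1

end PercRepro
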